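import Summits.Ventures.WeilGRH.ReflectionCriterion
import HarnessLib

/-!
# GRH arm (rh-explicit, venture WeilGRH): the two-budget reflection criterion — monotonicity and numbers

Service lemmas for `TwoPrimeReflectionRungs.lean` (independent of the analytic files): the cleared
two-prime criterion `2·[C_M ((B−δ)² − k'²σ) + 2B ((B−δ)·C_A − k'·ρ·I_A)] ≤ B ((B−δ)² − k'²σ)` with an
outer budget `B` and an inner budget `B' = B − δ` is monotone in its constants
(`reflection_criterion_of_bounds₂`) and affine in `σ` on the curve `ρ = σ/2`, improving with `ρ`
(`reflection_criterion_interpolate₂`); `k₃' = log 3/√3 ≤ 0.6343`; the constants of the window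
`a = 59/100` through `e^{59/100} ∈ [1.8039884, 1.8039885]` (`C_M ≤ 0.206478`, `C_A ≤ 0.504178`,
`I_A ≥ 0.504029`) and of `a = log 2` exactly (`C_M = 0`, `C_A = (3/4 + log 2)/2 ≤ 0.721574`,
`I_A = 3√2 log 2/8 + √2/4 ≥ 0.721149`).

## References

* Mathlib's `Real.log_two_near_10`, `Real.log_three_near_10`, `Real.exp_bound`; folklore.
-/

noncomputable section

open Complex Filter Set MeasureTheory
open scoped Real Topology ComplexConjugate

namespace Summit.Ventures.WeilGRH

open Literature.NumberTheory.LFunctions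

/-! ## The cleared two-budget criterion: monotonicity and interpolation -/

/-- Monotonicity of the two-budget criterion (`B` outer, `B'` inner) in its constants. [folklore] -/
theorem reflection_criterion_of_bounds₂ {CM CA IA k ρ σ B B' CMu CAu IAl kl ku : ℝ}
    (hCM : CM ≤ CMu) (hCA : CA ≤ CAu) (hIA : IAl ≤ IA) (hIAl : 0 ≤ IAl) (hρ : 0 ≤ ρ)
    (hσ : 0 ≤ σ) (hkl : kl ≤ k) (hku : k ≤ ku) (hkl0 : 0 ≤ kl) (hB : 0 < B) (hB' : 0 < B')
    (hCMu : 0 ≤ CMu) (hBk : ku ^ 2 * σ ≤ B' ^ 2)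
    (hnum : 2 * (CMu * (B' ^ 2 - kl ^ 2 * σ) + 2 * B * (B' * CAu - kl * ρ * IAl)) ≤
      B * (B' ^ 2 - ku ^ 2 * σ)) :
    2 * (CM * (B' ^ 2 - k ^ 2 * σ) + 2 * B * (B' * CA - k * ρ * IA)) ≤ B * (B' ^ 2 - k ^ 2 * σ) := by
  have hk0 : 0 ≤ k := hkl0.trans hkl
  have e1 : k ^ 2 * σ ≤ ku ^ 2 * σ := mul_le_mul_of_nonneg_right (pow_le_pow_left₀ hk0 hku 2) hσ
  have e2 : kl ^ 2 * σ ≤ k ^ 2 * σ := mul_le_mul_of_nonneg_right (pow_le_pow_left₀ hkl0 hkl 2) hσ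
  have e3 : CM * (B' ^ 2 - k ^ 2 * σ) ≤ CMu * (B' ^ 2 - k ^ 2 * σ) :=
    mul_le_mul_of_nonneg_right hCM (by linarith)
  have e4 : CMu * (B' ^ 2 - k ^ 2 * σ) ≤ CMu * (B' ^ 2 - kl ^ 2 * σ) :=
    mul_le_mul_of_nonneg_left (by linarith) hCMu
  have e5 : kl * ρ * IAl ≤ k * ρ * IA :=
    mul_le_mul (mul_le_mul_of_nonneg_right hkl hρ) hIA hIAl (mul_nonneg hk0 hρ)
  have e6 : B' * CA ≤ B' * CAu := mul_le_mul_of_nonneg_left hCA hB'.le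
  have e7 : 2 * B * (B' * CA - k * ρ * IA) ≤ 2 * B * (B' * CAu - kl * ρ * IAl) :=
    mul_le_mul_of_nonneg_left (by linarith) (by linarith)
  have e8 : B * (B' ^ 2 - ku ^ 2 * σ) ≤ B * (B' ^ 2 - k ^ 2 * σ) :=
    mul_le_mul_of_nonneg_left (by linarith) hB.le
  linarith

/-- Affine interpolation of the two-budget criterion on the curve `ρ = σ/2`, and monotonicity in
`ρ ≥ σ/2`. [folklore] -/
theorem reflection_criterion_interpolate₂ {CM CA IA k B B' σ₀ σ₁ σ ρ : ℝ} (hk : 0 ≤ k)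
    (hIA : 0 ≤ IA) (hB : 0 ≤ B)
    (h0 : 2 * (CM * (B' ^ 2 - k ^ 2 * σ₀) + 2 * B * (B' * CA - k * (σ₀ / 2) * IA)) ≤
      B * (B' ^ 2 - k ^ 2 * σ₀))
    (h1 : 2 * (CM * (B' ^ 2 - k ^ 2 * σ₁) + 2 * B * (B' * CA - k * (σ₁ / 2) * IA)) ≤
      B * (B' ^ 2 - k ^ 2 * σ₁))
    (hσ0 : σ₀ ≤ σ) (hσ1 : σ ≤ σ₁) (hρ : σ / 2 ≤ ρ) :
    2 * (CM * (B' ^ 2 - k ^ 2 * σ) + 2 * B * (B' * CA - k * ρ * IA)) ≤ B * (B' ^ 2 - k ^ 2 * σ) := by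
  have hcurve : 2 * (CM * (B' ^ 2 - k ^ 2 * σ) + 2 * B * (B' * CA - k * (σ / 2) * IA)) ≤
      B * (B' ^ 2 - k ^ 2 * σ) := by
    rcases eq_or_lt_of_le (hσ0.trans hσ1) with heq | hlt
    · have hσ : σ = σ₀ := le_antisymm (heq ▸ hσ1) hσ0
      rw [hσ]; exact h0
    · have key : (σ₁ - σ₀) * (B * (B' ^ 2 - k ^ 2 * σ) -
          2 * (CM * (B' ^ 2 - k ^ 2 * σ) + 2 * B * (B' * CA - k * (σ / 2) * IA))) =
          (σ₁ - σ) * (B * (B' ^ 2 - k ^ 2 * σ₀) -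
            2 * (CM * (B' ^ 2 - k ^ 2 * σ₀) + 2 * B * (B' * CA - k * (σ₀ / 2) * IA))) +
          (σ - σ₀) * (B * (B' ^ 2 - k ^ 2 * σ₁) -
            2 * (CM * (B' ^ 2 - k ^ 2 * σ₁) + 2 * B * (B' * CA - k * (σ₁ / 2) * IA))) := by
        ring
      have hnn : 0 ≤ (σ₁ - σ₀) * (B * (B' ^ 2 - k ^ 2 * σ) -
          2 * (CM * (B' ^ 2 - k ^ 2 * σ) + 2 * B * (B' * CA - k * (σ / 2) * IA))) := by
        rw [key]
        exact add_nonneg (mul_nonneg (by linarith) (by linarith))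
          (mul_nonneg (by linarith) (by linarith))
      have hpos : 0 < σ₁ - σ₀ := by linarith
      have := nonneg_of_mul_nonneg_right (by rwa [mul_comm] at hnn) hpos
      linarith
  have hgain : 2 * B * (B' * CA - k * ρ * IA) ≤ 2 * B * (B' * CA - k * (σ / 2) * IA) := by
    have : k * (σ / 2) * IA ≤ k * ρ * IA :=
      mul_le_mul_of_nonneg_right (mul_le_mul_of_nonneg_left hρ hk) hIA
    exact mul_le_mul_of_nonneg_left (by linarith) (by linarith)
  linarith

/-! ## Numerical constants -/

/-- `k₃' = log 3/√3 ≤ 0.6343`. [folklore] -/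
theorem kthree_le : Real.log 3 / Real.sqrt 3 ≤ 0.6343 := by
  obtain ⟨ht1, ht2⟩ := sqrt_three_bounds
  rw [div_le_iff₀ (by positivity)]
  linarith [Real.log_three_lt_d9]

/-- `1.8039884 ≤ e^{59/100} ≤ 1.8039885` (Taylor with remainder, 10 terms). [folklore] -/
theorem exp_fiftynine_bounds :
    (1.8039884 : ℝ) ≤ Real.exp (59 / 100) ∧ Real.exp (59 / 100) ≤ 1.8039885 := by
  have h := Real.exp_bound (x := 59 / 100) (by rw [abs_of_nonneg (by norm_num)]; norm_num)
    (n := 10) (by norm_num)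
  have hs : (∑ m ∈ Finset.range 10, (59 / 100 : ℝ) ^ m / m.factorial) =
      1 + 59 / 100 + (59 / 100) ^ 2 / 2 + (59 / 100) ^ 3 / 6 + (59 / 100) ^ 4 / 24 +
        (59 / 100) ^ 5 / 120 + (59 / 100) ^ 6 / 720 + (59 / 100) ^ 7 / 5040 +
        (59 / 100) ^ 8 / 40320 + (59 / 100) ^ 9 / 362880 := by
    simp [Finset.sum_range_succ, Nat.factorial]
  rw [hs, abs_of_nonneg (by norm_num : (0 : ℝ) ≤ 59 / 100)] at h
  norm_num [Nat.factorial] at h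
  obtain ⟨h1, h2⟩ := abs_sub_le_iff.1 h
  constructor <;> linarith

/-- The constants of the rung `59/100` (`E = e^{59/100}`): `C_M ≤ 0.206478`, `C_A ≤ 0.504178`,
`0.504029 ≤ I_A`. [folklore] -/
theorem fiftynine_constants :
    Real.sinh (Real.log 2 - 59 / 100) + (Real.log 2 - 59 / 100) ≤ 0.206478 ∧
    (Real.sinh (59 / 100) - Real.sinh (Real.log 2 - 59 / 100) +
        (59 / 100 - (Real.log 2 - 59 / 100))) / 2 ≤ 0.504178 ∧
    (0.504029 : ℝ) ≤ (59 / 100 - (Real.log 2 - 59 / 100)) * Real.cosh (Real.log 2 / 2) / 2 +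
        Real.sinh (59 / 100 - Real.log 2 / 2) := by
  obtain ⟨hs1, hs2⟩ := sqrt_two_bounds
  obtain ⟨he1, he2⟩ := exp_fiftynine_bounds
  have hl1 := Real.log_two_gt_d9
  have hl2 := Real.log_two_lt_d9
  set E := Real.exp (59 / 100) with hE
  have hE0 : 0 < E := Real.exp_pos _
  have hsq : Real.sqrt 2 * Real.sqrt 2 = 2 := Real.mul_self_sqrt (by norm_num)
  have hs0 : 0 < Real.sqrt 2 := by positivity
  have he2' : Real.exp (Real.log 2 / 2) = Real.sqrt 2 := by
    rw [Real.sqrt_eq_rpow, Real.rpow_def_of_pos (by norm_num : (0:ℝ) < 2)]; ring_nf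
  have hsinh1 : Real.sinh (59 / 100) = (E - E⁻¹) / 2 := by
    rw [Real.sinh_eq, Real.exp_neg]
  have hsinh2 : Real.sinh (Real.log 2 - 59 / 100) = E⁻¹ - E / 4 := by
    rw [Real.sinh_eq, Real.exp_neg, Real.exp_sub, Real.exp_log (by norm_num), ← hE]
    field_simp
    ring
  have hsinh3 : Real.sinh (59 / 100 - Real.log 2 / 2) = (E / Real.sqrt 2 - Real.sqrt 2 / E) / 2 := by
    rw [Real.sinh_eq, Real.exp_neg, Real.exp_sub, he2', ← hE]
    field_simp
  have hinv1 : E⁻¹ ≤ 1 / 1.8039884 := by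
    rw [inv_eq_one_div]; exact one_div_le_one_div_of_le (by norm_num) he1
  have hinv2 : 1 / 1.8039885 ≤ E⁻¹ := by
    rw [inv_eq_one_div]; exact one_div_le_one_div_of_le hE0 he2
  rw [hsinh1, hsinh2, hsinh3, cosh_log_two_half]
  refine ⟨?_, ?_, ?_⟩
  · norm_num at hinv1 ⊢; linarith
  · norm_num at hinv2 ⊢; linarith
  · have hq1 : (1.8039884 : ℝ) / 1.414214 ≤ E / Real.sqrt 2 := by
      rw [div_le_div_iff₀ (by norm_num) hs0]; nlinarith
    have hq2 : Real.sqrt 2 / E ≤ 1.414214 / 1.8039884 := by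
      rw [div_le_div_iff₀ hE0 (by norm_num)]; nlinarith
    norm_num at hq1 hq2 ⊢
    nlinarith

/-- The constants of the rung `log 2` (`m = 0`): `C_M = 0`, `C_A = (3/4 + log 2)/2 ≤ 0.721574`,
`I_A = 3√2·log 2/8 + √2/4 ≥ 0.721149`. [folklore] -/
theorem log_two_constants :
    Real.sinh (Real.log 2 - Real.log 2) + (Real.log 2 - Real.log 2) ≤ 0 ∧
    (Real.sinh (Real.log 2) - Real.sinh (Real.log 2 - Real.log 2) +
        (Real.log 2 - (Real.log 2 - Real.log 2))) / 2 ≤ 0.721574 ∧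
    (0.721149 : ℝ) ≤ (Real.log 2 - (Real.log 2 - Real.log 2)) * Real.cosh (Real.log 2 / 2) / 2 +
        Real.sinh (Real.log 2 - Real.log 2 / 2) := by
  obtain ⟨hs1, hs2⟩ := sqrt_two_bounds
  have hl1 := Real.log_two_gt_d9
  have hl2 := Real.log_two_lt_d9
  have hsq : Real.sqrt 2 * Real.sqrt 2 = 2 := Real.mul_self_sqrt (by norm_num)
  have hs0 : Real.sqrt 2 ≠ 0 := by positivity
  have he2' : Real.exp (Real.log 2 / 2) = Real.sqrt 2 := by
    rw [Real.sqrt_eq_rpow, Real.rpow_def_of_pos (by norm_num : (0:ℝ) < 2)]; ring_nf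
  have hsinh1 : Real.sinh (Real.log 2) = 3 / 4 := by
    rw [Real.sinh_eq, Real.exp_neg, Real.exp_log (by norm_num)]; norm_num
  have hsinh2 : Real.sinh (Real.log 2 - Real.log 2 / 2) = Real.sqrt 2 / 4 := by
    rw [show Real.log 2 - Real.log 2 / 2 = Real.log 2 / 2 by ring, Real.sinh_eq, Real.exp_neg, he2']
    field_simp
    nlinarith [hsq]
  rw [sub_self, Real.sinh_zero, sub_zero, sub_zero, hsinh1, hsinh2, cosh_log_two_half]
  refine ⟨by norm_num, by linarith, by nlinarith⟩

variable {q : ℕ}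

/-- `‖1 − χ(3)‖ ≤ 2`. [folklore] -/
theorem norm_one_sub_char_three_le (χ : DirichletCharacter ℂ q) : ‖1 - χ (3 : ZMod q)‖ ≤ 2 :=
  calc ‖1 - χ (3 : ZMod q)‖ ≤ ‖(1 : ℂ)‖ + ‖χ (3 : ZMod q)‖ := norm_sub_le _ _
    _ ≤ 1 + 1 := by rw [norm_one]; exact add_le_add le_rfl (χ.norm_le_one _)
    _ = 2 := by norm_num

end Summit.Ventures.WeilGRH
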